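import Summits.AtomisticToContinuum.Crystallization.Theorems.HullExactificationCascadeRobustBarlowTemplateTransportSteps1

/-!
# Line `registered` (crux `RobustBarlowTemplate`, stmt-AtomisticToContinuum-12088): the four in-layer transports `I, J, I⁻¹, J⁻¹` and the vertical transport `V` of frames read in scale-relative integer charts (specifications, inverse identities, apexes) (part 4: the `I⁻¹`-step)

Helper lemmas for `develop_transport` (the geometric half of the line): frames `⟨x, t₁, t₂, U⟩`
read in the scale-relative integer charts `IsZChart` of an everywhere-good configuration with
reciprocal shells, their transports and the coherence of the resulting development `frameAt`.
The only metric inputs are the chart transfer lemma (`develop_transfer`, through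
`transfer_nb_nb` / `transfer_nb_centre` of part 1) and `bond_nb_iff`; everything else is label
combinatorics in `ℤ³` (pattern facts `PalmUnimodularRigidityShellsToBarlowChartTransportPatterns*`
of the closed sibling crux `ShellsToBarlowChart`, stmt-9227, imported verbatim).  All `[folklore]`
(HalesDSP2012 §1.3 for the two kissing patterns).

## Port notes
This file is the port of `PalmUnimodularRigidityShellsToBarlowChartTransportSteps4.lean`
(stmt-9227) to the SHELL relation of this crux, following verbatim the rules recorded in part 1
(`…RobustBarlowTemplateTransportSteps1`, "Port notes"):
* charts are `hch : ∀ z ∈ S, IsZChart S z (Pc z) (Ac z) (nb z)` (no scale family `ac`);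
* the bond window `0 < dist a b ∧ dist a b ≤ 28/25` is replaced throughout by `b ∈ shell S a`
  (in the statement of `IinvStep_spec`: the conjuncts `nb x (−t₁) ∈ shell S x` and
  `nb x cm ∈ shell S (nb x (−t₁))`, at the positions of the two bond conjuncts of the source);
* `bond_symm h` becomes `hsy a ha b h` for the standing reciprocity hypothesis
  `hsy : ∀ x ∈ S, ∀ y ∈ shell S x, x ∈ shell S y`, threaded right after `hch` (it is passed to
  `transfer_nb_nb`, `transfer_nb_centre`, `hcp_of_mirror_pair` of part 1);
* `(hch x hx).sqNormInt_eq ht` becomes `zchart_sqNormInt_eq (hch x hx) ht`;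
* the theorem name `IinvStep_spec`, its docstring and the order of all other hypotheses and
  conjuncts are those of the source; the `open … hiding …` line is the one of part 1;
* `transportSteps4_anchor` (explicit-`∀` wrapper of the first two conjuncts of `IinvStep_spec`)
  is the registered anchor of this file.
-/

noncomputable section

namespace Summit.AtomisticToContinuum.Crystallization.Theorems.HullExactificationCascadeRobustBarlowTemplate

open Literature.Geometry.DiscreteGeometry Literature.MathematicalPhysics.StatisticalMechanics
open Summit.AtomisticToContinuum.Crystallization.Theorems.PalmUnimodularRigidityShellsToBarlowChart hiding
  IsZChart TransportSystem scales_tied sqNormInt_transfer bond_symm nb_mem zlab_spec zlab_nb bond_nb_iff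
  pattern_cases transfer_nb_nb transfer_nb_centre transfer_nb_target sqNormInt_zlab_centre hcp_of_mirror_pair

variable {S : Set (EuclideanSpace ℝ (Fin 3))} {Pc : (EuclideanSpace ℝ (Fin 3)) → Finset (Fin 3 → ℤ)}
  {Ac : (EuclideanSpace ℝ (Fin 3)) → ((EuclideanSpace ℝ (Fin 3)) →ₗᵢ[ℝ] (EuclideanSpace ℝ (Fin 3)))}
  {nb : (EuclideanSpace ℝ (Fin 3)) → (Fin 3 → ℤ) → (EuclideanSpace ℝ (Fin 3))}

/-- **The I⁻¹-step.**  For a valid frame `⟨x, t₁, t₂, U⟩` in the admissible regime, `IinvStep`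
lands at the shell-adjacent site `y = nb x (−t₁)`, produces a valid frame of the same parity, the
type propagates, and the labels at `y` of `x`, `nb x (t₂ − t₁)`, `nb x (−t₂)` are `w`, `v`, `w − v`
with `−w, −v` labels; the new upper cap is the cap of the label `μ` of the transported
reference `nb x cm`, `cm` the unique `U`-element touching `−t₁`, and `μ` is its unique element
touching `w`. [folklore] -/
theorem IinvStep_spec (hch : ∀ z ∈ S, IsZChart S z (Pc z) (Ac z) (nb z)) (hsy : ∀ x ∈ S, ∀ y ∈ shell S x, x ∈ shell S y) {x : (EuclideanSpace ℝ (Fin 3))} (hx : x ∈ S) {t₁ t₂ : Fin 3 → ℤ} {U : Finset (Fin 3 → ℤ)} (hU : IsFrame (Pc x) t₁ t₂ U) (hreg : Pc (nb x (-t₁)) = fcc3Int ∨ Pc x = hcpInt ∨ (-zlab Pc nb (nb x (-t₁)) x ∈ Pc (nb x (-t₁)) ∧ -zlab Pc nb (nb x (-t₁)) (nb x (t₂ - t₁)) ∈ Pc (nb x (-t₁)))) : nb x (-t₁) ∈ S ∧ nb x (-t₁) ∈ shell S x ∧ zlab Pc nb (nb x (-t₁)) x ∈ Pc (nb x (-t₁))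 ∧ nb (nb x (-t₁)) (zlab Pc nb (nb x (-t₁)) x) = x ∧ zlab Pc nb (nb x (-t₁)) (nb x (t₂ - t₁)) ∈ Pc (nb x (-t₁)) ∧ nb (nb x (-t₁)) (zlab Pc nb (nb x (-t₁)) (nb x (t₂ - t₁))) = nb x (t₂ - t₁) ∧ -zlab Pc nb (nb x (-t₁)) x ∈ Pc (nb x (-t₁)) ∧ -zlab Pc nb (nb x (-t₁)) (nb x (t₂ - t₁)) ∈ Pc (nb x (-t₁)) ∧ sqNormInt (zlab Pc nb (nb x (-t₁)) x - zlab Pc nb (nb x (-t₁)) (nb x (t₂ - t₁))) = 18 ∧ zlab Pc nb (nb x (-t₁)) (nb x (-t₂)) = zlab Pc nb (nb x (-t₁)) x - zlab Pc nb (nb x (-t₁)) (nb x (t₂ - t₁)) ∧ (Pc x = hcpInt → Pc (nb x (-t₁)) = hcpInt) ∧ IsFrame (Pc (nb x (-t₁))) (IinvStep Pc nb ⟨x, t₁, t₂, U⟩).t₁ (IinvStep Pc nb ⟨x, t₁, t₂, U⟩).t₂ (IinvStep Pc nb ⟨x, t₁, t₂, U⟩).U ∧ frameParity (IinvStep Pc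 nb ⟨x, t₁, t₂, U⟩).t₁ (IinvStep Pc nb ⟨x, t₁, t₂, U⟩).t₂ (IinvStep Pc nb ⟨x, t₁, t₂, U⟩).U = frameParity t₁ t₂ U ∧ ∃ cm ∈ U, sqNormInt (cm + t₁) = 18 ∧ U.filter (fun e => sqNormInt (e + t₁) = 18) = {cm} ∧ nb x cm ∈ shell S (nb x (-t₁)) ∧ zlab Pc nb (nb x (-t₁)) (nb x cm) ∈ (IinvStep Pc nb ⟨x, t₁, t₂, U⟩).U ∧ (IinvStep Pc nb ⟨x, t₁, t₂, U⟩).U = capWithAny (Pc (nb x (-t₁))) (IinvStep Pc nb ⟨x, t₁, t₂, U⟩).t₁ (IinvStep Pc nb ⟨x, t₁, t₂, U⟩).t₂ {zlab Pc nb (nb x (-t₁)) (nb x cm)} ∧ (IinvStep Pc nb ⟨x, t₁, t₂, U⟩).U.filter (fun e => sqNormInt (e - (IinvStep Pc nb ⟨x, t₁, t₂, U⟩).t₁) = 18) = {zlab Pc nb (nb x (-t₁)) (nb x cm)} := by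
  obtain ⟨h12, hhex, hUP, hoff, c, hcU, hform⟩ := hU
  have hPx := pattern_cases hch hx
  have ht₁ : t₁ ∈ Pc x := hhex (mem_hexLabels_iff.2 (Or.inl rfl))
  have ht₂ : t₂ ∈ Pc x := hhex (mem_hexLabels_iff.2 (Or.inr (Or.inl rfl)))
  have ht21 : t₂ - t₁ ∈ Pc x := hhex (mem_hexLabels_iff.2 (Or.inr (Or.inr (Or.inl rfl))))
  have hnt₁ : -t₁ ∈ Pc x := hhex (mem_hexLabels_iff.2 (Or.inr (Or.inr (Or.inr (Or.inl rfl)))))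
  have hnt₂ : -t₂ ∈ Pc x := hhex (mem_hexLabels_iff.2 (Or.inr (Or.inr (Or.inr (Or.inr (Or.inl rfl))))))
  have hcP : c ∈ Pc x := hUP hcU
  have hc : c ∉ hexLabels t₁ t₂ := hoff c hcU
  have hhx := dist_hexagon (Pc x) hPx t₁ ht₁ t₂ ht₂ h12 hhex
  -- the new site
  have hy := nb_mem hch hx hnt₁
  have hPy := pattern_cases hch hy.1
  -- shell-adjacency from `y` to `K = nb x (t₂ - t₁)` and `J⁻ = nb x (-t₂)`
  have hbK : nb x (t₂ - t₁) ∈ shell S (nb x (-t₁)) :=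
    (bond_nb_iff hch hx hnt₁ ht21).2 hhx.2.2.2.2.2.2.2.2.2.2.1
  have hbJ : nb x (-t₂) ∈ shell S (nb x (-t₁)) :=
    (bond_nb_iff hch hx hnt₁ hnt₂).2 (by
      rw [show -t₁ - -t₂ = t₂ - t₁ by abel, sqNormInt_sub_comm]; exact h12)
  -- labels at `y`
  have hw := zlab_spec hch hy.1 hx (hsy x hx _ hy.2)
  have hv := zlab_spec hch hy.1 (nb_mem hch hx ht21).1 hbK
  have hθ := zlab_spec hch hy.1 (nb_mem hch hx hnt₂).1 hbJ
  set w := zlab Pc nb (nb x (-t₁)) x with hw_def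
  set v := zlab Pc nb (nb x (-t₁)) (nb x (t₂ - t₁)) with hv_def
  set θ := zlab Pc nb (nb x (-t₁)) (nb x (-t₂)) with hθ_def
  -- transfers among `x, K, J⁻`
  have Dvw : sqNormInt (v - w) = 18 := by
    rw [hv_def, hw_def, transfer_nb_centre hch hsy hx hy.1 hy.2 ht21 hbK, sqNormInt_sub_comm]; exact h12
  have Dwv : sqNormInt (w - v) = 18 := by rw [sqNormInt_sub_comm]; exact Dvw
  have Dθw : sqNormInt (θ - w) = 18 := by
    rw [hθ_def, hw_def, transfer_nb_centre hch hsy hx hy.1 hy.2 hnt₂ hbJ, sqNormInt_neg]; exact hhx.2.1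
  have Dθv : sqNormInt (θ - v) = 54 := by
    rw [hθ_def, hv_def, transfer_nb_nb hch hsy hx hy.1 hy.2 hnt₂ ht21 hbJ hbK,
      show -t₂ - (t₂ - t₁) = -(2 • t₂ - t₁) by abel, sqNormInt_neg]
    exact hhx.2.2.2.2.1
  rcases hform with hE | hO
  · /- EVEN source cap: reference `cm = c - t₁` -/
    have hc1 : c - t₁ ∈ Pc x := hUP (by rw [hE]; simp)
    have hc2 : c - t₂ ∈ Pc x := hUP (by rw [hE]; simp)
    have hdx := dist_evenCap (Pc x) hPx t₁ ht₁ t₂ ht₂ c hcP h12 hhex hc hc1 hc2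
    have hbu : nb x (c - t₁) ∈ shell S (nb x (-t₁)) :=
      (bond_nb_iff hch hx hnt₁ hc1).2 hdx.2.2.2.2.2.2.1
    have hμ := zlab_spec hch hy.1 (nb_mem hch hx hc1).1 hbu
    set μ := zlab Pc nb (nb x (-t₁)) (nb x (c - t₁)) with hμ_def
    have Dμw : sqNormInt (μ - w) = 18 := by
      rw [hμ_def, hw_def, transfer_nb_centre hch hsy hx hy.1 hy.2 hc1 hbu]
      exact zchart_sqNormInt_eq (hch x hx) hc1
    have Dwμ : sqNormInt (w - μ) = 18 := by rw [sqNormInt_sub_comm]; exact Dμw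
    have Dvμ : sqNormInt (v - μ) = 18 := by
      rw [hv_def, hμ_def, transfer_nb_nb hch hsy hx hy.1 hy.2 ht21 hc1 hbK hbu]
      exact hdx.2.2.2.2.2.2.2.2.1
    have hsym : -w ∈ Pc (nb x (-t₁)) ∧ -v ∈ Pc (nb x (-t₁)) ∧
        (Pc x = hcpInt → Pc (nb x (-t₁)) = hcpInt) := by
      by_cases hxh : Pc x = hcpInt
      · have hfr : ∀ q, q ∈ hcpInt ↔ q ∈ Pc x := fun q => by rw [hxh]
        obtain ⟨d, hd, h48, hd1, hd2, hdoff, hL⟩ := lowerCap_evenCap_hcp t₁ ((hfr _).2 ht₁) t₂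
          ((hfr _).2 ht₂) c ((hfr _).2 hcP) h12 (by rw [hxh] at hhex; exact hhex) hc
          ((hfr _).2 hc1) ((hfr _).2 hc2)
        have hdP : d ∈ Pc x := (hfr d).1 (mem_lowerCap_iff.1 hd).1
        have hd1P : d - t₁ ∈ Pc x := (hfr _).1 hd1
        have hdx' := dist_evenCap (Pc x) hPx t₁ ht₁ t₂ ht₂ d hdP h12 hhex hdoff hd1P ((hfr _).1 hd2)
        have h48' : sqNormInt (c - t₁ - (d - t₁)) = 48 := by
          rw [show c - t₁ - (d - t₁) = c - d by abel]; exact h48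
        have hbl : nb x (d - t₁) ∈ shell S (nb x (-t₁)) :=
          (bond_nb_iff hch hx hnt₁ hd1P).2 hdx'.2.2.2.2.2.2.1
        obtain ⟨hPy', heq⟩ := hcp_of_mirror_pair hch hsy hx hnt₁ hc1 hd1P h48' hbu hbl
        have hlam := zlab_spec hch hy.1 (nb_mem hch hx hd1P).1 hbl
        have Dwlam : sqNormInt (w - zlab Pc nb (nb x (-t₁)) (nb x (d - t₁))) = 18 := by
          rw [sqNormInt_sub_comm, hw_def, transfer_nb_centre hch hsy hx hy.1 hy.2 hd1P hbl]
          exact zchart_sqNormInt_eq (hch x hx) hd1P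
        have Dvlam : sqNormInt (v - zlab Pc nb (nb x (-t₁)) (nb x (d - t₁))) = 18 := by
          rw [hv_def, transfer_nb_nb hch hsy hx hy.1 hy.2 ht21 hd1P hbK hbl]
          exact hdx'.2.2.2.2.2.2.2.2.1
        exact ⟨heq w hw.1 Dwμ Dwlam, heq v hv.1 Dvμ Dvlam, fun _ => hPy'⟩
      · have hS : -w ∈ Pc (nb x (-t₁)) ∧ -v ∈ Pc (nb x (-t₁)) := by
          rcases hreg with hA | hB | hS
          · constructor
            · rw [hA] at hw ⊢; exact neg_mem_fcc3Int w hw.1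
            · rw [hA] at hv ⊢; exact neg_mem_fcc3Int v hv.1
          · exact (hxh hB).elim
          · exact hS
        exact ⟨hS.1, hS.2, fun h => (hxh h).elim⟩
    obtain ⟨hnw, hnv, htype⟩ := hsym
    have hhexwv : hexLabels w v ⊆ Pc (nb x (-t₁)) :=
      hexLabels_subset_of_symm (Pc (nb x (-t₁))) hPy w hw.1 v hv.1 Dwv hnw hnv
    have hwv : w - v ∈ Pc (nb x (-t₁)) :=
      hhexwv (mem_hexLabels_iff.2 (Or.inr (Or.inr (Or.inr (Or.inr (Or.inr rfl))))))
    have hθeq : θ = w - v :=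
      label_third_vertex (Pc (nb x (-t₁))) hPy v hv.1 w hw.1 θ hθ.1 Dvw Dθw Dθv hwv
    obtain ⟨hframe, hpar, hcap⟩ :=
      apex_Iinv_even (Pc (nb x (-t₁))) hPy w hw.1 v hv.1 μ hμ.1 hnw hnv Dwv Dwμ Dvμ
    have hfilt : U.filter (fun e => sqNormInt (e + t₁) = 18) = {c - t₁} := by
      rw [hE]; exact (filter_evenCap (Pc x) hPx t₁ ht₁ t₂ ht₂ c hcP h12 hhex hc hc1 hc2).2.2.1
    have hI : IinvStep Pc nb ⟨x, t₁, t₂, U⟩ =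
        ⟨nb x (-t₁), w, v, ({μ, μ - w, μ - v} : Finset (Fin 3 → ℤ))⟩ := by
      have h1 : IinvStep Pc nb ⟨x, t₁, t₂, U⟩ =
          ⟨nb x (-t₁), w, v, capWithAny (Pc (nb x (-t₁))) w v {μ}⟩ := by
        simp only [IinvStep, hfilt, Finset.image_singleton]
        try rfl
      rw [h1, hcap]
    have hparx : frameParity t₁ t₂ U = 1 := by
      rw [hE]; exact (isFrame_evenCap (Pc x) hPx t₁ ht₁ t₂ ht₂ c hcP h12 hhex hc hc1 hc2).2
    have hfilt' : ({μ, μ - w, μ - v} : Finset (Fin 3 → ℤ)).filter (fun e => sqNormInt (e - w) = 18) = {μ} := by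
      obtain ⟨-, -, hUP', hoff', _⟩ := hframe
      exact (filter_evenCap (Pc (nb x (-t₁))) hPy w hw.1 v hv.1 μ hμ.1 Dwv hhexwv
        (hoff' μ (by simp)) (hUP' (by simp)) (hUP' (by simp))).1
    refine ⟨hy.1, hy.2, hw.1, hw.2, hv.1, hv.2, hnw, hnv, Dwv, hθeq, htype, ?_, ?_, c - t₁,
      (by rw [hE]; simp), (by rw [sub_add_cancel]; exact zchart_sqNormInt_eq (hch x hx) hcP), hfilt, hbu,
      ?_, ?_, ?_⟩
    · rw [hI]; exact hframe
    · rw [hI, hparx]; exact hpar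
    · rw [hI]; show μ ∈ _; simp
    · rw [hI]; exact hcap.symm
    · rw [hI]; exact hfilt'
  · /- ODD source cap: reference `cm = c` -/
    have hc1 : c + t₁ ∈ Pc x := hUP (by rw [hO]; simp)
    have hc2 : c + t₂ ∈ Pc x := hUP (by rw [hO]; simp)
    have hdx := dist_oddCap (Pc x) hPx t₁ ht₁ t₂ ht₂ c hcP h12 hhex hc hc1 hc2
    have hbu : nb x c ∈ shell S (nb x (-t₁)) :=
      (bond_nb_iff hch hx hnt₁ hcP).2 hdx.1
    have hμ := zlab_spec hch hy.1 (nb_mem hch hx hcP).1 hbu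
    set μ := zlab Pc nb (nb x (-t₁)) (nb x c) with hμ_def
    have Dμw : sqNormInt (μ - w) = 18 := by
      rw [hμ_def, hw_def, transfer_nb_centre hch hsy hx hy.1 hy.2 hcP hbu]
      exact zchart_sqNormInt_eq (hch x hx) hcP
    have Dwμ : sqNormInt (w - μ) = 18 := by rw [sqNormInt_sub_comm]; exact Dμw
    have Dθμ : sqNormInt (θ - μ) = 18 := by
      rw [hθ_def, hμ_def, transfer_nb_nb hch hsy hx hy.1 hy.2 hnt₂ hcP hbJ hbu]; exact hdx.2.1
    have Dvμ : sqNormInt (v - μ) = 36 := by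
      rw [hv_def, hμ_def, transfer_nb_nb hch hsy hx hy.1 hy.2 ht21 hcP hbK hbu,
        show t₂ - t₁ - c = t₂ - (c + t₁) by abel]
      exact hdx.2.2.2.2.1
    have hsym : -w ∈ Pc (nb x (-t₁)) ∧ -v ∈ Pc (nb x (-t₁)) ∧
        (Pc x = hcpInt → Pc (nb x (-t₁)) = hcpInt) := by
      by_cases hxh : Pc x = hcpInt
      · have hfr : ∀ q, q ∈ hcpInt ↔ q ∈ Pc x := fun q => by rw [hxh]
        obtain ⟨d, hd, h48, hd1, hd2, hdoff, hL⟩ := lowerCap_oddCap_hcp t₁ ((hfr _).2 ht₁) t₂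
          ((hfr _).2 ht₂) c ((hfr _).2 hcP) h12 (by rw [hxh] at hhex; exact hhex) hc
          ((hfr _).2 hc1) ((hfr _).2 hc2)
        have hdP : d ∈ Pc x := (hfr d).1 (mem_lowerCap_iff.1 hd).1
        have hdx' := dist_oddCap (Pc x) hPx t₁ ht₁ t₂ ht₂ d hdP h12 hhex hdoff ((hfr _).1 hd1)
          ((hfr _).1 hd2)
        have hbl : nb x d ∈ shell S (nb x (-t₁)) :=
          (bond_nb_iff hch hx hnt₁ hdP).2 hdx'.1
        obtain ⟨hPy', heq⟩ := hcp_of_mirror_pair hch hsy hx hnt₁ hcP hdP h48 hbu hbl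
        have hlam := zlab_spec hch hy.1 (nb_mem hch hx hdP).1 hbl
        have Dwlam : sqNormInt (w - zlab Pc nb (nb x (-t₁)) (nb x d)) = 18 := by
          rw [sqNormInt_sub_comm, hw_def, transfer_nb_centre hch hsy hx hy.1 hy.2 hdP hbl]
          exact zchart_sqNormInt_eq (hch x hx) hdP
        have Dθlam : sqNormInt (θ - zlab Pc nb (nb x (-t₁)) (nb x d)) = 18 := by
          rw [hθ_def, transfer_nb_nb hch hsy hx hy.1 hy.2 hnt₂ hdP hbJ hbl]; exact hdx'.2.1
        have hnw : -w ∈ Pc (nb x (-t₁)) := heq w hw.1 Dwμ Dwlam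
        have hnθ : -θ ∈ Pc (nb x (-t₁)) := heq θ hθ.1 Dθμ Dθlam
        have hnv : -v ∈ Pc (nb x (-t₁)) := by
          have hwP := hw.1; have hθP := hθ.1; have hvP := hv.1
          rw [hPy'] at hwP hθP hvP hnw hnθ ⊢
          exact neg_mem_of_chain w hwP θ hθP v hvP hnw hnθ Dwv
            (by rw [sqNormInt_sub_comm]; exact Dθw) (by rw [sqNormInt_sub_comm]; exact Dθv)
        exact ⟨hnw, hnv, fun _ => hPy'⟩
      · have hS : -w ∈ Pc (nb x (-t₁)) ∧ -v ∈ Pc (nb x (-t₁)) := by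
          rcases hreg with hA | hB | hS
          · constructor
            · rw [hA] at hw ⊢; exact neg_mem_fcc3Int w hw.1
            · rw [hA] at hv ⊢; exact neg_mem_fcc3Int v hv.1
          · exact (hxh hB).elim
          · exact hS
        exact ⟨hS.1, hS.2, fun h => (hxh h).elim⟩
    obtain ⟨hnw, hnv, htype⟩ := hsym
    have hhexwv : hexLabels w v ⊆ Pc (nb x (-t₁)) :=
      hexLabels_subset_of_symm (Pc (nb x (-t₁))) hPy w hw.1 v hv.1 Dwv hnw hnv
    have hwv : w - v ∈ Pc (nb x (-t₁)) :=
      hhexwv (mem_hexLabels_iff.2 (Or.inr (Or.inr (Or.inr (Or.inr (Or.inr rfl))))))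
    have hθeq : θ = w - v :=
      label_third_vertex (Pc (nb x (-t₁))) hPy v hv.1 w hw.1 θ hθ.1 Dvw Dθw Dθv hwv
    have Dwvμ : sqNormInt (w - v - μ) = 18 := by rw [← hθeq]; exact Dθμ
    obtain ⟨hframe, hpar, hcap⟩ :=
      apex_Iinv_odd (Pc (nb x (-t₁))) hPy w hw.1 v hv.1 μ hμ.1 hnw hnv Dwv Dwμ Dwvμ Dvμ
    have hfilt : U.filter (fun e => sqNormInt (e + t₁) = 18) = {c} := by
      rw [hO]; exact (filter_oddCap (Pc x) hPx t₁ ht₁ t₂ ht₂ c hcP h12 hhex hc hc1 hc2).2.2.1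
    have hI : IinvStep Pc nb ⟨x, t₁, t₂, U⟩ =
        ⟨nb x (-t₁), w, v, ({μ - w, μ, μ - w + v} : Finset (Fin 3 → ℤ))⟩ := by
      have h1 : IinvStep Pc nb ⟨x, t₁, t₂, U⟩ =
          ⟨nb x (-t₁), w, v, capWithAny (Pc (nb x (-t₁))) w v {μ}⟩ := by
        simp only [IinvStep, hfilt, Finset.image_singleton]
        try rfl
      rw [h1, hcap]
    have hparx : frameParity t₁ t₂ U = -1 := by
      rw [hO]; exact (isFrame_oddCap (Pc x) hPx t₁ ht₁ t₂ ht₂ c hcP h12 hhex hc hc1 hc2).2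
    have hfilt' : ({μ - w, μ, μ - w + v} : Finset (Fin 3 → ℤ)).filter (fun e => sqNormInt (e - w) = 18) = {μ} := by
      obtain ⟨-, -, hUP', hoff', _⟩ := hframe
      have := (filter_oddCap (Pc (nb x (-t₁))) hPy w hw.1 v hv.1 (μ - w) (hUP' (by simp)) Dwv hhexwv
        (hoff' (μ - w) (by simp)) (by rw [sub_add_cancel]; exact hμ.1) (hUP' (by simp))).1
      rw [show μ - w + w = μ by abel] at this
      exact this
    have hct : sqNormInt (c + t₁) = 18 := by
      have h0 := hdx.1
      rw [show -t₁ - c = -(c + t₁) by abel, sqNormInt_neg] at h0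
      exact h0
    refine ⟨hy.1, hy.2, hw.1, hw.2, hv.1, hv.2, hnw, hnv, Dwv, hθeq, htype, ?_, ?_, c,
      hcU, hct, hfilt, hbu, ?_, ?_, ?_⟩
    · rw [hI]; exact hframe
    · rw [hI, hparx]; exact hpar
    · rw [hI]; show μ ∈ _; simp
    · rw [hI]; exact hcap.symm
    · rw [hI]; exact hfilt'

/-- Anchor (registered sub-goal of stmt-AtomisticToContinuum-12088, toward `develop_transport`):
the `I⁻¹`-step of a valid frame in the admissible regime lands at a site of `S` in the first
shell of the source site (the first two conjuncts of `IinvStep_spec`). [folklore] -/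
theorem transportSteps4_anchor : ∀ (S : Set (EuclideanSpace ℝ (Fin 3))) (Pc : EuclideanSpace ℝ (Fin 3) → Finset (Fin 3 → ℤ)) (Ac : EuclideanSpace ℝ (Fin 3) → (EuclideanSpace ℝ (Fin 3) →ₗᵢ[ℝ] EuclideanSpace ℝ (Fin 3))) (nb : EuclideanSpace ℝ (Fin 3) → (Fin 3 → ℤ) → EuclideanSpace ℝ (Fin 3)), (∀ z ∈ S, IsZChart S z (Pc z) (Ac z) (nb z)) → (∀ x ∈ S, ∀ y ∈ shell S x, x ∈ shell S y) → ∀ x ∈ S, ∀ (t₁ t₂ : Fin 3 → ℤ) (U : Finset (Fin 3 → ℤ)), IsFrame (Pc x) t₁ t₂ U → (Pc (nb x (-t₁)) = fcc3Int ∨ Pc x = hcpInt ∨ (-zlab Pc nb (nb x (-t₁)) x ∈ Pc (nb x (-t₁)) ∧ -zlab Pc nb (nb x (-t₁)) (nb x (t₂ - t₁)) ∈ Pc (nb x (-t₁)))) → nb x (-t₁) ∈ S ∧ nb x (-t₁) ∈ shell S x := by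
  intro S Pc Ac nb hch hsy x hx t₁ t₂ U hU hreg
  have h := IinvStep_spec hch hsy hx hU hreg
  exact ⟨h.1, h.2.1⟩

end Summit.AtomisticToContinuum.Crystallization.Theorems.HullExactificationCascadeRobustBarlowTemplate

end
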